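import Summits.QuantumFields.YangMills.Theorems.BalabanUVNodesN15KingModelRungUnit
import Summits.QuantumFields.YangMills.Theorems.BalabanUVNodesN18KingModelTorusDeriv

/-!
# BalabanUVNodes ∕ N15 — THE KING-MODEL RUNG, PART 3: NE2's SITE-LAYER OBJECT in King's `A = 0` model — THE H-KERNEL,
# King's block-spin MINIMISER `ℋ_K = a_KG^η_KQ^*_K` and its lattice derivative `∂^η_μℋ_K` (Prop. 3.8 (3.71), lines 1–2), read
# through SUP-OVER-THE-BLOCK entries under King's two-lattice pairing, on Bałaban's volumes: objects, majorants, uniform rates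
# (Track A, DAG node N15 = NE2; FAN-OUT v1.1 §N15 s3 «KING-MODEL ∕ RIEMANN-KERNEL RUNG», door (iii) of the n15-d∕n15-e split)

HONEST FRAMING.  Count-neutral kernel bookkeeping (cell `pub-ymgap`, seat `pub-ymgap-dag-n15-e` g2, strategy s3 «alternative
currency»; `--supports stmt-QuantumFields-19676` = K3 `SpineGivenEndpointR11`).  King's `A = 0` SCALAR MODEL ([King1986], TEMPLATE
literature, printed AND proved; its torus theorems are the tree's `King1986.Torus.*`, seat n18-b) — NOT Bałaban's covariant minimiser
`H_k(U)` of [Balaban1985BackgroundPropagators] Sect. D, for which NE2⁺ is NOT PRINTED and not proved; NOT a node discharge; finite tori;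
nothing continuum ∕ ℝ⁴ ∕ OS ∕ mass-gap ∕ Clay.  0 `sorry`, standard axioms; the `def`s are plumbing (King's pairing map, kernels written
out, a block fibre, a carrier bundle).

THE POINT.  Node N15's SITE layer `T4EtaRate.NE2PlusSite` is typed for three [B9] kernels on `𝔅` (docstring of `EtaRateIneqSite`):
`(Q′G′²Q′*)⁻¹` (3.48), `(QGQ*)⁻¹` (3.132), and *«p ∈ {0, 1}, δ = ½δ₁ for the sup entries of the H-kernel (3.133)»* — the H-KERNEL being
Bałaban's minimiser (fine field from the field on `𝔅`).  Its `A = 0` scalar analogue is King's block-spin minimiser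
`ℋ_k = a_kG^η_kQ^*_k` ([King1986] (2.13)–(2.15) p. 653; the kernel that «replaces the propagators on the external lines», p. 664),
whose two-spacing rate IS PRINTED AND PROVED — Proposition 3.8 p. 664: *"When x′ ∈ T_{η′}, we denote by x that point in T_η for which
x′ ∈ B^n(x). … |a_{k+n}G^{η′}_{k+n}Q^*_{k+n}(x′, z) − a_kG^η_kQ^*_k(x, z)|, |a_{k+n}∂^{η′}_μG^{η′}_{k+n}Q^*_{k+n}(x′, z) −
a_k∂^η_μG^η_kQ^*_k(x, z)|, … ≦ CL^{−γk} exp[−δ₀{|x − z|, dist({x, y}, z)}]. (3.71)"* — and is in the tree UNCONDITIONALLY on Bałaban's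
volumes `M_μ = 2L^m` in King's block-distance currency: line 1 `King1986.Torus.king_prop38_torus_blocks` (`MinimizerBlockDecay`), line 2
`King1986.Torus.king_prop38_deriv_torus_blocks` (`MinimizerTwoSpacingDeriv`), with Theorem 3.3's decay `minimiser_kernel_decay_blocks` ∕
`dminimiser_kernel_decay_blocks`.  Parts 1–2 of this rung (`…N15KingModelRung`, `…N15KingModelRungUnit`, seat g0) read the operator and
site layers on King's propagator top piece `G^η_{(K)}` at block BASE POINTS and the unit layer on `(Δ^{(K)})⁻¹`; the sibling
`…N15KingModelNE2` (seat n15-d) reads all three layers on King's `C^{(k)}` and says *«`ℋ_K`∕`(Q_kG_kQ_k*)⁻¹` analogues NOT COVERED»*.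
THIS FILE reads NE2's site layer on THE H-KERNEL ITSELF, with NO base-point collapse: the η-difference entry at (observation unit site
`y`, source unit site `b`) is the SUP OVER EVERY FINE POINT OF THE BLOCK,
  `kingHStep(y, b) = sup_{x′ ∈ T_{η′}, B(x′) = y} |ℋ_{K+1}(x′, b) − ℋ_K(x, b)|`  (`x` under `x′`, King p. 664),
and the derivative entry `dkingHStep(y, b) = sup_{B(x′) = y} Σ_μ |∂^{η′}_μℋ_{K+1}(x′, b) − ∂^η_μℋ_K(x, b)|` — exactly the intended reading
of the η-difference family (`T4EtaRate.PairedInstance` docstring: *«sup_{x′ ∈ Δ(ι y)} |(G^{η′} τλ)(x′) − (G^{η} λ)(x)| with x′ ∈ B^n(x)»*).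
Concretely, for `d + 1 ≥ 1`, odd `L ≥ 3`, `a > 0`, `m² > 0`:
* §1 THE OBJECTS on part 1's carriers `kingVolInstance d L` (unit torus `Π_μ ℤ∕(2L^m)`, `K` coarse scales, fine run `K + 1`, identity
  pairing on unit sites, one-point backgrounds): `underPt` (King's pairing map `x_μ = ⌊x′_μ∕L⌋`, `val_underPt`, `blockOf_underPt`: over
  `x′` and under it lies the same unit block), `kingH` (`ℋ_K(x, b) = minimiser (L^K) M a_K L^{2K} m² δ_b x`, the ACTUAL operator of
  `King1986.EffectiveLaplacianSymbol`), `dkingH` (`∂^η_μℋ_K = L^K(ℋ_K(· + e_μ, b) − ℋ_K(·, b))`), `kingHStepAt` ∕ `dkingHStepAt` (level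
  `K + 1` at `x′` minus level `K` under it), `kingBlockFibre` (the block of a unit site as a `Finset` of fine points; inhabited by the
  base point), the sup entries `kingHStep` ∕ `dkingHStep` and the site kernels `kingHSite` ∕ `dkingHSite`.
* §2 THE (3.133)-SHAPE MAJORANTS THEMSELVES, by name (`kingH_decay` ∕ `dkingH_decay` ⇐ `minimiser_row_decay` ∕ `dminimiser_row_decay`:
  `|ℋ_K(x, b)|, |∂^η_μℋ_K(x, b)| ≤ a·c₀·e^{−δ₀|B(x) − b|_T}`, every level, volume, point) — [B9] Thm 3.14's typing template *«their difference
  satisfies all the inequalities characteristic for operators of the considered type, with the additional factor»* made literal in the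
  model: the differences below obey the SAME shape times the rate `(L^{−γ∕2})^K`.
* §3 THE STEP BOUNDS, ONE CONSTANT FOR ALL LEVELS AND VOLUMES: **`kingHStepAt_le`** (`0 ≤ γ ≤ 1`) ∕ **`dkingHStepAt_le`** (`0 ≤ γ < 1`, the
  derivative line's alias exponent): `≤ C·e^{−δ·|B(x′) − b|_T}·(L^{−γ∕2})^K` at EVERY fine point `x′` — (3.71) lines 1–2 at `n = 1` with the
  `K`-dependence of King's constants removed by `N18KingModelTorus.outerRate_le_unif` ∕ `N18KingModelTorusDeriv.douterRate_le_unif` BY NAME;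
  hence the sup entries `kingHStep_le` ∕ `dkingHStep_le`.
* PART 4 (`…N15KingModelMinimizerNode`, the next file) reads the layer off §3: `ne2PlusSite_kingH` ∕ `ne2PlusSite_dkingH`
  (`NE2PlusSite d′ p c35` on `kingVolInstance d L`, hypothesis-free) and the node shape `n15At_kingModelRungH : N15At (kingVolCarriersH …)`
  (operator layer = King's propagator piece, SITE layer = King's H-kernel, unit layer = King's block-field covariance).
WHAT THE CURVED CASE ADDS (H-layer, one line): Bałaban's NE2⁺ site layer asks this inequality for the `U`-DEPENDENT minimiser `H_k(U)` of
[B9] Sect. D on the multiscale `𝔅 = ⋃_j Λ_j` with the `(L^jη)^{−p}(L^{j′}η)^{−d}` prefactors of (3.133), UNIFORMLY over the live window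
`Reg335 c35 α₀ U` ((3.35)); in print the background control is analyticity in `U` (Thm 3.4, tree `B9.Thm34Printed`) and uniformity in `η`,
never an η-difference (`T4EtaRate` header, GAPS G-t4-U1a-1); on the model's one-point background sort NE2⁺ ⟺ NE2⁰ (part 2 §3).
HONEST SCOPE.  (i) `A = 0`: every `NE2Plus…` conclusion quantifies its background over `{U ≡ 1}`; (ii) single top scale (the model's tower
has one scale; sources are unit sites, observations are read over whole unit blocks of the finest lattice); (iii) objects = King's scalar
`ℋ_K` on Bałaban's volumes `2L^m`, odd `L ≥ 3` (standing hypotheses of the n18-b chain; the decay input is certified for these volumes);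
the Hölder-quotient lines 3–4 of (3.71) are [B9]'s Hölder entries (3.43)–(3.45), which `T4EtaRate` does not type, and are not read.
Locators: [King1986] C. King, CMP **102** (1986) 649–677: (2.13)–(2.15) p. 653, Thm 3.3 (3.7) p. 658, Prop. 3.7 (3.64) p. 663, p. 664
(pairing) + Prop. 3.8 (3.71) p. 664, p. 674; [B9] = [Balaban1985BackgroundPropagators] CMP **99** (1985): (3.35) p. 396, Thm 3.2 (3.48)
p. 398, Thm 3.4 p. 400, (3.132)–(3.133) p. 422, Thm 3.14 pp. 426–427 (typing template).
-/

noncomputable section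

namespace Summit.QuantumFields.YangMills.BalabanUVNodes.N15KingModelRung

open Real Finset
open Literature.MathematicalPhysics.QuantumFieldTheory.Balaban1983to89
open Literature.MathematicalPhysics.QuantumFieldTheory.Balaban1983to89.B5Prop11Plancherel (Tor fine unitVec)
open Literature.MathematicalPhysics.QuantumFieldTheory.King1986 (aK prop38RateConst prop38PosConst dprop38RateConst dprop38PosConst
  lemma43Const)
open Literature.MathematicalPhysics.QuantumFieldTheory.King1986.Torus (minimiser blockOf blockOf_over tdistT tdistT_nonneg
  king_prop38_torus_blocks king_prop38_deriv_torus_blocks minimiser_row_decay dminimiser_row_decay)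
open Summit.QuantumFields.YangMills.BalabanUVNodes.N18KingModelTorus (outerRate_le_unif)
open Summit.QuantumFields.YangMills.BalabanUVNodes.N18KingModelTorusDeriv (douterRate_le_unif)

variable {d : ℕ}

/-! ## §1 The objects: King's pairing map, the minimiser kernels, the block fibre, the sup entries -/

section Object

variable (L : ℕ) [NeZero L]

/-- KING'S PAIRING MAP (level `K` under level `K + 1`): the point `x` of `T_η` under `x′ ∈ T_{η′}`, `x_μ = ⌊x′_μ∕L⌋` — *"When
x′ ∈ T_{η′}, we denote by x that point in T_η for which x′ ∈ B^n(x)"* (`n = 1`). [cite: King1986, p.664 (before Prop. 3.8)] -/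
def underPt (K : ℕ) (M : Fin (d + 1) → ℕ) (x' : Tor (fine (L ^ 1 * L ^ K) M)) : Tor (fine (L ^ K) M) :=
  fun μ => (((x' μ).val / L ^ 1 : ℕ) : ZMod (fine (L ^ K) M μ))

/-- Its coordinates: `x_μ = ⌊x′_μ∕L⌋` (no wrap-around). [cite: King1986, p.664 (before Prop. 3.8)] -/
theorem val_underPt (K : ℕ) (M : Fin (d + 1) → ℕ) [∀ μ, NeZero (M μ)] (x' : Tor (fine (L ^ 1 * L ^ K) M)) (μ : Fin (d + 1)) :
    (underPt L K M x' μ).val = (x' μ).val / L ^ 1 := by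
  have hlt : (x' μ).val < L ^ 1 * L ^ K * M μ := ZMod.val_lt (x' μ)
  have hdiv : (x' μ).val / L ^ 1 < L ^ K * M μ := Nat.div_lt_of_lt_mul (by rw [← mul_assoc]; exact hlt)
  show (((x' μ).val / L ^ 1 : ℕ) : ZMod (L ^ K * M μ)).val = (x' μ).val / L ^ 1
  rw [ZMod.val_natCast, Nat.mod_eq_of_lt hdiv]

/-- Over `x′` and under it lies the SAME unit block: `B(x) = B(x′)` (`blockOf_over`). [cite: King1986, p.664 («x′ ∈ B^n(x)»)] -/
theorem blockOf_underPt (K : ℕ) (M : Fin (d + 1) → ℕ) [∀ μ, NeZero (M μ)] (x' : Tor (fine (L ^ 1 * L ^ K) M)) :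
    blockOf (L ^ K) M (underPt L K M x') = blockOf (L ^ 1 * L ^ K) M x' :=
  (blockOf_over M (underPt L K M x') x' (val_underPt L K M x')).symm

/-- KING'S BLOCK-SPIN MINIMISER KERNEL `ℋ_k(x, b) = (a_kG^η_kQ^*_kδ_b)(x)` on the fine torus with `Nf` sites per unit block side
(`Nf = L^k`), for the volume `M`: the ACTUAL operator `minimiser Nf M a_k Nf² m² δ_b` of `King1986.EffectiveLaplacianSymbol`
(`A₀ = Nf²(−Δ) + m² + a_kQ*Q` = King's `Δ^η + m²` in `η`-units, `a_k = aK a L k` of (2.13)). [cite: King1986, (2.13)–(2.15) p.653, Prop. 3.8 p.664 (object)] -/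
def kingH (Nf : ℕ) [NeZero Nf] (M : Fin (d + 1) → ℕ) [∀ μ, NeZero (M μ)] (a m2 : ℝ) (k : ℕ) (b : Tor M)
    (x : Tor (fine Nf M)) : ℝ :=
  minimiser Nf M (aK a L k) (((Nf : ℕ) : ℝ) ^ 2) m2 (Pi.single b 1) x

/-- ITS FORWARD LATTICE DERIVATIVE in unit-lattice units, `∂^η_μℋ_k(x, b) = Nf·(ℋ_k(x + e_μ, b) − ℋ_k(x, b))` (`η⁻¹ = Nf`).
[cite: King1986, Prop. 3.8 (3.71) p.664 (second line, object)] -/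
def dkingH (Nf : ℕ) [NeZero Nf] (M : Fin (d + 1) → ℕ) [∀ μ, NeZero (M μ)] (a m2 : ℝ) (k : ℕ) (b : Tor M) (μ : Fin (d + 1))
    (x : Tor (fine Nf M)) : ℝ :=
  ((Nf : ℕ) : ℝ) * (kingH L Nf M a m2 k b (x + unitVec (fine Nf M) μ) - kingH L Nf M a m2 k b x)

/-- THE PAIRED η-DIFFERENCE OF THE MINIMISER AT A FINE POINT of index `j`: `ℋ_{K+1}(x′, b) − ℋ_K(x, b)`, `x` under `x′`
(fine tori `L·L^K` resp. `L^K` sites per unit block side over the unit torus `2L^m`). [cite: King1986, Prop. 3.8 (3.71) p.664 (first line)] -/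
def kingHStepAt (a m2 : ℝ) (j : KingVolIndex d) (b : Tor (kingVol L j)) (x' : Tor (fine (L ^ 1 * L ^ j.K) (kingVol L j))) : ℝ :=
  haveI := kingVol_neZero L j
  kingH L (L ^ 1 * L ^ j.K) (kingVol L j) a m2 (j.K + 1) b x' - kingH L (L ^ j.K) (kingVol L j) a m2 j.K b (underPt L j.K (kingVol L j) x')

/-- … and of its derivative: `∂^{η′}_μℋ_{K+1}(x′, b) − ∂^η_μℋ_K(x, b)`. [cite: King1986, Prop. 3.8 (3.71) p.664 (second line)] -/
def dkingHStepAt (a m2 : ℝ) (j : KingVolIndex d) (b : Tor (kingVol L j)) (μ : Fin (d + 1))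
    (x' : Tor (fine (L ^ 1 * L ^ j.K) (kingVol L j))) : ℝ :=
  haveI := kingVol_neZero L j
  dkingH L (L ^ 1 * L ^ j.K) (kingVol L j) a m2 (j.K + 1) b μ x' - dkingH L (L ^ j.K) (kingVol L j) a m2 j.K b μ (underPt L j.K (kingVol L j) x')

omit [NeZero L] in
/-- THE BLOCK OF A UNIT SITE as a finite set of fine points: `{x ∈ T : B(x) = y}`. [cite: King1986, p.664 (blocks `B^n(x)`)] -/
def kingBlockFibre (Nf : ℕ) [NeZero Nf] (M : Fin (d + 1) → ℕ) [∀ μ, NeZero (M μ)] (y : Tor M) : Finset (Tor (fine Nf M)) :=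
  Finset.univ.filter (fun x => blockOf Nf M x = y)

omit [NeZero L] in
/-- Membership in the block fibre is `B(x) = y`. [folklore] -/
theorem mem_kingBlockFibre (Nf : ℕ) [NeZero Nf] (M : Fin (d + 1) → ℕ) [∀ μ, NeZero (M μ)] (y : Tor M) (x : Tor (fine Nf M)) :
    x ∈ kingBlockFibre Nf M y ↔ blockOf Nf M x = y := by
  simp [kingBlockFibre]

omit [NeZero L] in
/-- The base point of the block lies in the block fibre. [folklore] -/
theorem basePt_mem_kingBlockFibre (Nf : ℕ) [NeZero Nf] (M : Fin (d + 1) → ℕ) [∀ μ, NeZero (M μ)] (y : Tor M) :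
    basePt Nf M y ∈ kingBlockFibre Nf M y :=
  (mem_kingBlockFibre Nf M y _).2 (blockOf_basePt Nf M y)

omit [NeZero L] in
/-- The block fibre is nonempty. [folklore] -/
theorem kingBlockFibre_nonempty (Nf : ℕ) [NeZero Nf] (M : Fin (d + 1) → ℕ) [∀ μ, NeZero (M μ)] (y : Tor M) :
    (kingBlockFibre Nf M y).Nonempty :=
  ⟨_, basePt_mem_kingBlockFibre Nf M y⟩

/-- **THE H-KERNEL'S η-DIFFERENCE SUP ENTRY** at observation unit site `y` and source unit site `b`:
`sup_{x′ ∈ T_{η′}, B(x′) = y} |ℋ_{K+1}(x′, b) − ℋ_K(x, b)|` — every fine point of the block is read (the `p = 0` sup entry of the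
H-kernel, [B9] (3.133), for the difference family). [cite: Balaban1985BackgroundPropagators, (3.133) p.422 (sup-entry shape); King1986, Prop. 3.8 (3.71) p.664 (object)] -/
def kingHStep (a m2 : ℝ) (j : KingVolIndex d) (y b : Tor (kingVol L j)) : ℝ :=
  haveI := kingVol_neZero L j
  (kingBlockFibre (L ^ 1 * L ^ j.K) (kingVol L j) y).sup' (kingBlockFibre_nonempty _ _ y) fun x' => |kingHStepAt L a m2 j b x'|

/-- **THE DERIVATIVE SUP ENTRY**: `sup_{B(x′) = y} Σ_μ |∂^{η′}_μℋ_{K+1}(x′, b) − ∂^η_μℋ_K(x, b)|` (the `p = 1` entry). [cite: Balaban1985BackgroundPropagators, (3.133) p.422 (sup-entry shape); King1986, Prop. 3.8 (3.71) p.664 (second line)] -/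
def dkingHStep (a m2 : ℝ) (j : KingVolIndex d) (y b : Tor (kingVol L j)) : ℝ :=
  haveI := kingVol_neZero L j
  (kingBlockFibre (L ^ 1 * L ^ j.K) (kingVol L j) y).sup' (kingBlockFibre_nonempty _ _ y) fun x' => ∑ μ, |dkingHStepAt L a m2 j b μ x'|

/-- The sup entry is nonnegative. [folklore] -/
theorem kingHStep_nonneg (a m2 : ℝ) (j : KingVolIndex d) (y b : Tor (kingVol L j)) : 0 ≤ kingHStep L a m2 j y b := by
  haveI := kingVol_neZero L j
  exact (abs_nonneg _).trans
    (Finset.le_sup' (fun x' => |kingHStepAt L a m2 j b x'|) (basePt_mem_kingBlockFibre (L ^ 1 * L ^ j.K) (kingVol L j) y))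

/-- The derivative sup entry is nonnegative. [folklore] -/
theorem dkingHStep_nonneg (a m2 : ℝ) (j : KingVolIndex d) (y b : Tor (kingVol L j)) : 0 ≤ dkingHStep L a m2 j y b := by
  haveI := kingVol_neZero L j
  exact (Finset.sum_nonneg fun μ _ => abs_nonneg _).trans
    (Finset.le_sup' (fun x' => ∑ μ, |dkingHStepAt L a m2 j b μ x'|)
      (basePt_mem_kingBlockFibre (L ^ 1 * L ^ j.K) (kingVol L j) y))

/-- THE H-KERNEL's η-difference as a SITE kernel on the King-model family (observation site first, source site second).
[cite: Balaban1985BackgroundPropagators, (3.133) p.422 (shape); King1986, Prop. 3.8 p.664 (object)] -/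
def kingHSite (a m2 : ℝ) : ∀ j : KingVolIndex d, B9.SiteKernel (kingVolInstance d L j).gc (kingVolInstance d L j).Bf :=
  fun j => ⟨fun _ y b => kingHStep L a m2 j y b⟩

/-- Its derivative companion as a SITE kernel. [cite: Balaban1985BackgroundPropagators, (3.133) p.422 (shape); King1986, Prop. 3.8 p.664 (object)] -/
def dkingHSite (a m2 : ℝ) : ∀ j : KingVolIndex d, B9.SiteKernel (kingVolInstance d L j).gc (kingVolInstance d L j).Bf :=
  fun j => ⟨fun _ y b => dkingHStep L a m2 j y b⟩

end Object

/-! ## §2 The (3.133)-shape majorants themselves: Theorem 3.3 ∕ Prop. 3.7 for `ℋ_K` and `∂ℋ_K`, by name -/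

section Majorant

variable (L : ℕ) [NeZero L]

/-- **THE UNIFORM DECAY OF THE MINIMISER KERNEL** (Theorem 3.3 ∕ Prop. 3.7 in King's block-distance currency, n18-b's
`minimiser_row_decay` BY NAME): for odd `L ≥ 3`, `a > 0`, `m² ≥ 0` there are `δ₀, c₀ > 0` with `|ℋ_K(x, b)| ≤ a·c₀·e^{−δ₀|B(x) − b|_T}`
for EVERY index (volume `2L^m`, level `K ≥ 1`), every fine point and unit site — the inequality «characteristic for operators of the
considered type» whose η-difference §3 carries the rate. [cite: King1986, Theorem 3.3 (3.7) p.658, Prop. 3.7 (3.64) p.663] -/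
theorem kingH_decay (hLodd : Odd L) (hL : 2 ≤ L) {a m2 : ℝ} (ha : 0 < a) (hm : 0 ≤ m2) :
    ∃ δ₀ c₀ : ℝ, 0 < δ₀ ∧ 0 < c₀ ∧ ∀ (j : KingVolIndex d) (b : Tor (kingVol L j)) (x : Tor (fine (L ^ j.K) (kingVol L j))),
      haveI := kingVol_neZero L j
      |kingH L (L ^ j.K) (kingVol L j) a m2 j.K b x|
        ≤ a * c₀ * Real.exp (-(δ₀ * tdistT (kingVol L j) (blockOf (L ^ j.K) (kingVol L j) x) b)) := by
  have hL1 : 1 < L := by omega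
  obtain ⟨δ₀, c₀, hδ₀, hc₀, H⟩ := minimiser_row_decay (d + 1) L (Nat.succ_pos d) ⟨hLodd, hL1⟩ ha hm
  refine ⟨δ₀, c₀, hδ₀, hc₀, fun j b x => ?_⟩
  haveI := kingVol_neZero L j
  exact H (j.params L hLodd hL) rfl rfl j.one_le_K (kingVol L j) (kingVol_eq_sitesPerDir L hLodd hL j) (L ^ j.K) rfl
    δ₀ hδ₀ le_rfl x b

/-- **THE UNIFORM DECAY OF ITS DERIVATIVE** (Theorem 3.3's derivative clause, n18-b's `dminimiser_row_decay` BY NAME):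
`|∂^η_μℋ_K(x, b)| ≤ a·c₀·e^{−δ₀|B(x) − b|_T}`, every index, point, site, direction. [cite: King1986, Theorem 3.3 (3.7) p.658, Prop. 3.7 (3.64) p.663] -/
theorem dkingH_decay (hLodd : Odd L) (hL : 2 ≤ L) {a m2 : ℝ} (ha : 0 < a) (hm : 0 ≤ m2) :
    ∃ δ₀ c₀ : ℝ, 0 < δ₀ ∧ 0 < c₀ ∧ ∀ (j : KingVolIndex d) (b : Tor (kingVol L j)) (μ : Fin (d + 1))
      (x : Tor (fine (L ^ j.K) (kingVol L j))),
      haveI := kingVol_neZero L j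
      |dkingH L (L ^ j.K) (kingVol L j) a m2 j.K b μ x|
        ≤ a * c₀ * Real.exp (-(δ₀ * tdistT (kingVol L j) (blockOf (L ^ j.K) (kingVol L j) x) b)) := by
  have hL1 : 1 < L := by omega
  obtain ⟨δ₀, c₀, hδ₀, hc₀, H⟩ := dminimiser_row_decay (d + 1) L (Nat.succ_pos d) ⟨hLodd, hL1⟩ ha hm
  refine ⟨δ₀, c₀, hδ₀, hc₀, fun j b μ x => ?_⟩
  haveI := kingVol_neZero L j
  exact H (j.params L hLodd hL) rfl rfl j.one_le_K (kingVol L j) (kingVol_eq_sitesPerDir L hLodd hL j) (L ^ j.K) rfl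
    δ₀ hδ₀ le_rfl x b μ

end Majorant

/-! ## §3 The step bounds: ONE constant for all levels, volumes and fine points -/

section Step

variable (L : ℕ) [NeZero L]

/-- **THE TWO-SPACING RATE OF THE MINIMISER AT EVERY FINE POINT, UNIFORMLY** — (3.71) line 1: for odd `L ≥ 3`, `a > 0`, `m² > 0`,
`0 ≤ γ ≤ 1` there are `C, δ > 0` (functions of `d, L, a, m², γ`) with
`|ℋ_{K+1}(x′, b) − ℋ_K(x, b)| ≤ C·e^{−δ|B(x′) − b|_T}·(L^{−γ∕2})^K` for EVERY index (volume `2L^m`, `K ≥ 1`), every unit site `b` and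
EVERY fine point `x′` (`x` under it) — `King1986.Torus.king_prop38_torus_blocks` at `n = 1`, its constant
`√((C₁(K,1) + C₂)L^{−γK}·2ac₀)` majorised uniformly in `K` by `N18KingModelTorus.outerRate_le_unif`. [cite: King1986, Prop. 3.8 (3.71) p.664, p.674] -/
theorem kingHStepAt_le (hLodd : Odd L) (hL : 2 ≤ L) {a m2 : ℝ} (ha : 0 < a) (hm : 0 < m2) {γ : ℝ} (hγ0 : 0 ≤ γ)
    (hγ1 : γ ≤ 1) :
    ∃ C δ : ℝ, 0 < C ∧ 0 < δ ∧ ∀ (j : KingVolIndex d) (b : Tor (kingVol L j))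
      (x' : Tor (fine (L ^ 1 * L ^ j.K) (kingVol L j))),
      haveI := kingVol_neZero L j
      |kingHStepAt L a m2 j b x'|
        ≤ C * Real.exp (-(δ * tdistT (kingVol L j) (blockOf (L ^ 1 * L ^ j.K) (kingVol L j) x') b)) * (((L : ℝ) ^ (-(γ / 2))) ^ j.K) := by
  obtain ⟨δ₀, c₀, hδ₀, hc₀, H⟩ := king_prop38_torus_blocks (d + 1) L (Nat.succ_pos d) hLodd hL ha hm hγ0 hγ1
  set Cu : ℝ := prop38RateConst a a (a * (2 * ((a * (1 - ((L : ℝ) ^ 2)⁻¹))⁻¹ + π ^ 2 / 48 + 1 / 3)))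
      ((π ^ 2 / 4) ^ (d + 1)) (d + 1) γ + prop38PosConst a ((π ^ 2 / 4) ^ (d + 1)) (d + 1) γ with hCu
  refine ⟨Real.sqrt (2 * (a * c₀) * Cu) + 1, δ₀ / 2, by positivity, half_pos hδ₀, fun j b x' => ?_⟩
  haveI := kingVol_neZero L j
  have hj := H (j.params L hLodd hL) rfl rfl j.one_le_K 1 le_rfl (kingVol L j) (kingVol_eq_sitesPerDir L hLodd hL j)
    (underPt L j.K (kingVol L j) x') x' b (val_underPt L j.K (kingVol L j) x')
  set s : ℝ := (L : ℝ) ^ (-(γ / 2)) with hs_def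
  have hs : 0 ≤ s := Real.rpow_nonneg (Nat.cast_nonneg _) _
  set E : ℝ := Real.exp (-(δ₀ / 2 * tdistT (kingVol L j) (blockOf (L ^ 1 * L ^ j.K) (kingVol L j) x') b)) with hE
  have hstep : |kingHStepAt L a m2 j b x'| ≤
      Real.sqrt ((prop38RateConst a a (lemma43Const a L j.K 1) ((π ^ 2 / 4) ^ (d + 1)) (d + 1) γ
            + prop38PosConst a ((π ^ 2 / 4) ^ (d + 1)) (d + 1) γ) * ((L ^ j.K : ℕ) : ℝ) ^ (-γ) * (2 * (a * c₀)))
        * Real.exp (-(δ₀ / 2 * tdistT (kingVol L j) (blockOf (L ^ j.K) (kingVol L j) (underPt L j.K (kingVol L j) x')) b)) := hj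
  rw [blockOf_underPt] at hstep
  have hC := outerRate_le_unif (d := d + 1) (Nat.succ_pos d) ha hL j.one_le_K (le_refl 1) hγ1 hc₀.le (K := j.K)
  calc |kingHStepAt L a m2 j b x'|
      ≤ Real.sqrt ((prop38RateConst a a (lemma43Const a L j.K 1) ((π ^ 2 / 4) ^ (d + 1)) (d + 1) γ
            + prop38PosConst a ((π ^ 2 / 4) ^ (d + 1)) (d + 1) γ) * ((L ^ j.K : ℕ) : ℝ) ^ (-γ) * (2 * (a * c₀))) * E := hstep
    _ ≤ Real.sqrt (2 * (a * c₀) * Cu) * s ^ j.K * E := mul_le_mul_of_nonneg_right hC (Real.exp_pos _).le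
    _ ≤ (Real.sqrt (2 * (a * c₀) * Cu) + 1) * s ^ j.K * E := by
        refine mul_le_mul_of_nonneg_right (mul_le_mul_of_nonneg_right (by linarith) (pow_nonneg hs _)) (Real.exp_pos _).le
    _ = (Real.sqrt (2 * (a * c₀) * Cu) + 1) * E * s ^ j.K := by ring

/-- **THE TWO-SPACING RATE OF THE DERIVATIVE AT EVERY FINE POINT, UNIFORMLY** — (3.71) line 2 (`0 ≤ γ < 1`):
`|∂^{η′}_μℋ_{K+1}(x′, b) − ∂^η_μℋ_K(x, b)| ≤ C·e^{−δ|B(x′) − b|_T}·(L^{−γ∕2})^K` — `king_prop38_deriv_torus_blocks` at `n = 1` +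
`N18KingModelTorusDeriv.douterRate_le_unif`. [cite: King1986, Prop. 3.8 (3.71) p.664 (second line), p.674] -/
theorem dkingHStepAt_le (hLodd : Odd L) (hL : 2 ≤ L) {a m2 : ℝ} (ha : 0 < a) (hm : 0 < m2) {γ : ℝ} (hγ0 : 0 ≤ γ)
    (hγ1 : γ < 1) :
    ∃ C δ : ℝ, 0 < C ∧ 0 < δ ∧ ∀ (j : KingVolIndex d) (b : Tor (kingVol L j)) (μ : Fin (d + 1))
      (x' : Tor (fine (L ^ 1 * L ^ j.K) (kingVol L j))),
      haveI := kingVol_neZero L j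
      |dkingHStepAt L a m2 j b μ x'|
        ≤ C * Real.exp (-(δ * tdistT (kingVol L j) (blockOf (L ^ 1 * L ^ j.K) (kingVol L j) x') b)) * (((L : ℝ) ^ (-(γ / 2))) ^ j.K) := by
  obtain ⟨δ₀, c₀, hδ₀, hc₀, H⟩ := king_prop38_deriv_torus_blocks (d + 1) L (Nat.succ_pos d) hLodd hL ha hm hγ0 hγ1
  set Cu : ℝ := dprop38RateConst a a (a * (2 * ((a * (1 - ((L : ℝ) ^ 2)⁻¹))⁻¹ + π ^ 2 / 48 + 1 / 3)))
      ((π ^ 2 / 4) ^ (d + 1)) (d + 1) γ + dprop38PosConst a ((π ^ 2 / 4) ^ (d + 1)) (d + 1) γ with hCu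
  refine ⟨Real.sqrt (2 * (a * c₀) * Cu) + 1, δ₀ / 2, by positivity, half_pos hδ₀, fun j b μ x' => ?_⟩
  haveI := kingVol_neZero L j
  have hj := H (j.params L hLodd hL) rfl rfl j.one_le_K 1 le_rfl (kingVol L j) (kingVol_eq_sitesPerDir L hLodd hL j)
    (underPt L j.K (kingVol L j) x') x' b (val_underPt L j.K (kingVol L j) x') μ
  set s : ℝ := (L : ℝ) ^ (-(γ / 2)) with hs_def
  have hs : 0 ≤ s := Real.rpow_nonneg (Nat.cast_nonneg _) _
  set E : ℝ := Real.exp (-(δ₀ / 2 * tdistT (kingVol L j) (blockOf (L ^ 1 * L ^ j.K) (kingVol L j) x') b)) with hE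
  have hstep : |dkingHStepAt L a m2 j b μ x'| ≤
      Real.sqrt ((dprop38RateConst a a (lemma43Const a L j.K 1) ((π ^ 2 / 4) ^ (d + 1)) (d + 1) γ
            + dprop38PosConst a ((π ^ 2 / 4) ^ (d + 1)) (d + 1) γ) * ((L ^ j.K : ℕ) : ℝ) ^ (-γ) * (2 * (a * c₀)))
        * Real.exp (-(δ₀ / 2 * tdistT (kingVol L j) (blockOf (L ^ j.K) (kingVol L j) (underPt L j.K (kingVol L j) x')) b)) := hj
  rw [blockOf_underPt] at hstep
  have hC := douterRate_le_unif (d := d + 1) (Nat.succ_pos d) ha hL j.one_le_K (le_refl 1) hγ1 hc₀.le (K := j.K)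
  calc |dkingHStepAt L a m2 j b μ x'|
      ≤ Real.sqrt ((dprop38RateConst a a (lemma43Const a L j.K 1) ((π ^ 2 / 4) ^ (d + 1)) (d + 1) γ
            + dprop38PosConst a ((π ^ 2 / 4) ^ (d + 1)) (d + 1) γ) * ((L ^ j.K : ℕ) : ℝ) ^ (-γ) * (2 * (a * c₀))) * E := hstep
    _ ≤ Real.sqrt (2 * (a * c₀) * Cu) * s ^ j.K * E := mul_le_mul_of_nonneg_right hC (Real.exp_pos _).le
    _ ≤ (Real.sqrt (2 * (a * c₀) * Cu) + 1) * s ^ j.K * E := by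
        refine mul_le_mul_of_nonneg_right (mul_le_mul_of_nonneg_right (by linarith) (pow_nonneg hs _)) (Real.exp_pos _).le
    _ = (Real.sqrt (2 * (a * c₀) * Cu) + 1) * E * s ^ j.K := by ring

/-- **THE SUP ENTRY'S RATE**: `kingHStep(y, b) ≤ C·e^{−δ|y − b|_T}·(L^{−γ∕2})^K` for every index and all unit sites (the sup over the block
of `y` of the pointwise bound, `B(x′) = y` on the fibre). [cite: King1986, Prop. 3.8 (3.71) p.664] -/
theorem kingHStep_le (hLodd : Odd L) (hL : 2 ≤ L) {a m2 : ℝ} (ha : 0 < a) (hm : 0 < m2) {γ : ℝ} (hγ0 : 0 ≤ γ) (hγ1 : γ ≤ 1) :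
    ∃ C δ : ℝ, 0 < C ∧ 0 < δ ∧ ∀ (j : KingVolIndex d) (y b : Tor (kingVol L j)),
      haveI := kingVol_neZero L j
      kingHStep L a m2 j y b ≤ C * Real.exp (-(δ * tdistT (kingVol L j) y b)) * (((L : ℝ) ^ (-(γ / 2))) ^ j.K) := by
  obtain ⟨C, δ, hC, hδ, H⟩ := kingHStepAt_le (d := d) L hLodd hL ha hm hγ0 hγ1
  refine ⟨C, δ, hC, hδ, fun j y b => ?_⟩
  haveI := kingVol_neZero L j
  refine Finset.sup'_le _ _ fun x' hx' => ?_
  have hblk : blockOf (L ^ 1 * L ^ j.K) (kingVol L j) x' = y := (mem_kingBlockFibre _ _ y x').1 hx'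
  have h := H j b x'
  rw [hblk] at h
  exact h

/-- **THE DERIVATIVE SUP ENTRY'S RATE**: `dkingHStep(y, b) ≤ (d+1)·C·e^{−δ|y − b|_T}·(L^{−γ∕2})^K` (`d + 1` directions). [cite: King1986, Prop. 3.8 (3.71) p.664 (second line)] -/
theorem dkingHStep_le (hLodd : Odd L) (hL : 2 ≤ L) {a m2 : ℝ} (ha : 0 < a) (hm : 0 < m2) {γ : ℝ} (hγ0 : 0 ≤ γ) (hγ1 : γ < 1) :
    ∃ C δ : ℝ, 0 < C ∧ 0 < δ ∧ ∀ (j : KingVolIndex d) (y b : Tor (kingVol L j)),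
      haveI := kingVol_neZero L j
      dkingHStep L a m2 j y b ≤ C * Real.exp (-(δ * tdistT (kingVol L j) y b)) * (((L : ℝ) ^ (-(γ / 2))) ^ j.K) := by
  obtain ⟨C, δ, hC, hδ, H⟩ := dkingHStepAt_le (d := d) L hLodd hL ha hm hγ0 hγ1
  refine ⟨(d + 1) * C, δ, by positivity, hδ, fun j y b => ?_⟩
  haveI := kingVol_neZero L j
  refine Finset.sup'_le _ _ fun x' hx' => ?_
  have hblk : blockOf (L ^ 1 * L ^ j.K) (kingVol L j) x' = y := (mem_kingBlockFibre _ _ y x').1 hx'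
  calc ∑ μ, |dkingHStepAt L a m2 j b μ x'|
      ≤ ∑ _μ : Fin (d + 1), C * Real.exp (-(δ * tdistT (kingVol L j) y b)) * (((L : ℝ) ^ (-(γ / 2))) ^ j.K) :=
        Finset.sum_le_sum fun μ _ => by
          have h := H j b μ x'
          rw [hblk] at h
          exact h
    _ = (d + 1) * C * Real.exp (-(δ * tdistT (kingVol L j) y b)) * (((L : ℝ) ^ (-(γ / 2))) ^ j.K) := by
        rw [Finset.sum_const, Finset.card_univ, Fintype.card_fin, nsmul_eq_mul]
        push_cast
        ring

end Step

end Summit.QuantumFields.YangMills.BalabanUVNodes.N15KingModelRung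

end
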